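import Literature.Analysis.FluidPDE.AdaptedBackwardKernel
import Literature.Analysis.FluidPDE.PressurePoisson
import Mathlib.Analysis.SpecialFunctions.SmoothTransition

/-!
# Crux `AdaptedKernelExists` (stmt-NavierStokesRegularity-2956), line `nash-entropy-last-block`:
  glue lemma — smooth temporal cut-off of a Type-I drift

Helper file (lands `--supports stmt-NavierStokesRegularity-2956`) used by the composition of the
line: the linear theorem `C⁺` is applied, for every `T′ < T`, to the drift `χ(t) • b` where `χ` is
a smooth step equal to `1` for `t ≤ T′` and to `0` near the pole; the cut-off drift is again
jointly smooth, divergence free, Type-I with the same constant, bounded, dominated by `b`, and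
vanishes on a final block — exactly the input of the existence theorem for a regular pole.

* `kernel_typeI_cutoff` — the construction (`χ(t) = Real.smoothTransition ((T₁ − t)/(T₁ − T′))`,
  `T₁ = (T′ + T)/2`);
* `stub_typeICutoff` — the registered sub-goal (explicit-argument form).
-/

noncomputable section

open Set
open scoped ContDiff
open Literature.Analysis.FluidPDE

namespace Summit.NavierStokesRegularity.NavierStokesRegularity.Theorems.AdaptedKernelExists.NashEntropyLastBlock

/-- **Smooth temporal cut-off.**  A jointly smooth, divergence-free drift `b` on `Ico tb T` with
the Type-I bound `‖b(t,x)‖ ≤ C/√(T−t)` and a time `T′ < T` admit a drift `b′ = χ(t) • b`,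
`χ(t) = Real.smoothTransition ((T₁ − t)/(T₁ − T′))`, `T₁ = (T′ + T)/2` (`χ = 1` for `t ≤ T′`,
`χ = 0` for `t ≥ T₁`, `0 ≤ χ ≤ 1`), which is again smooth, divergence free and Type-I with the SAME
constant on `Ico tb T`, coincides with `b` for `t ≤ T′`, is pointwise dominated by `b`, is bounded
(by `C/√(T − T₁)`), and vanishes on `[T₁, T)`, `T₁ ∈ Ioo T′ T`. -/
theorem kernel_typeI_cutoff {C tb T T' : ℝ}
    {b : ℝ → EuclideanSpace ℝ (Fin 3) → EuclideanSpace ℝ (Fin 3)} (hC : 0 ≤ C)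
    (hsm : IsSmoothSpaceTimeOn (Ico tb T) b)
    (hdiv : ∀ t ∈ Ico tb T, VectorCalculus.IsDivFree (b t))
    (hrate : ∀ t ∈ Ico tb T, ∀ x, ‖b t x‖ ≤ C / Real.sqrt (T - t))
    (hT' : T' < T) :
    ∃ b' : ℝ → EuclideanSpace ℝ (Fin 3) → EuclideanSpace ℝ (Fin 3),
      IsSmoothSpaceTimeOn (Ico tb T) b' ∧
      (∀ t ∈ Ico tb T, VectorCalculus.IsDivFree (b' t)) ∧
      (∀ t ∈ Ico tb T, ∀ x, ‖b' t x‖ ≤ C / Real.sqrt (T - t)) ∧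
      (∀ t ∈ Ico tb T, t ≤ T' → b' t = b t) ∧
      (∀ t x, ‖b' t x‖ ≤ ‖b t x‖) ∧
      (∃ B : ℝ, ∀ t ∈ Ico tb T, ∀ x, ‖b' t x‖ ≤ B) ∧
      (∃ T₁ ∈ Ioo T' T, ∀ t ∈ Ico T₁ T, ∀ x, b' t x = 0) := by
  set T₁ : ℝ := (T' + T) / 2 with hT₁_def
  have hT₁' : T' < T₁ := by rw [hT₁_def]; linarith
  have hT₁T : T₁ < T := by rw [hT₁_def]; linarith
  have hgap : 0 < T₁ - T' := sub_pos.2 hT₁'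
  -- the cut-off function
  set χ : ℝ → ℝ := fun t => Real.smoothTransition ((T₁ - t) / (T₁ - T')) with hχ_def
  have hχ0 : ∀ t, 0 ≤ χ t := fun t => Real.smoothTransition.nonneg _
  have hχ1 : ∀ t, χ t ≤ 1 := fun t => Real.smoothTransition.le_one _
  have hχone : ∀ t, t ≤ T' → χ t = 1 := by
    intro t ht
    apply Real.smoothTransition.one_of_one_le
    rw [le_div_iff₀ hgap]
    linarith
  have hχzero : ∀ t, T₁ ≤ t → χ t = 0 := by
    intro t ht
    apply Real.smoothTransition.zero_of_nonpos
    exact div_nonpos_of_nonpos_of_nonneg (by linarith) hgap.le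
  have hχs : ContDiff ℝ ∞ χ := by
    have h1 : ContDiff ℝ ∞ (fun t : ℝ => (T₁ - t) / (T₁ - T')) := by
      have : (fun t : ℝ => (T₁ - t) / (T₁ - T')) = fun t => (T₁ - T')⁻¹ * (T₁ - t) := by
        funext t; rw [div_eq_inv_mul]
      rw [this]
      fun_prop
    exact Real.smoothTransition.contDiff.comp h1
  -- pointwise norm control of the cut-off drift
  have hnorm : ∀ t x, ‖χ t • b t x‖ ≤ ‖b t x‖ := by
    intro t x
    rw [norm_smul, Real.norm_eq_abs, abs_of_nonneg (hχ0 t)]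
    calc χ t * ‖b t x‖ ≤ 1 * ‖b t x‖ := mul_le_mul_of_nonneg_right (hχ1 t) (norm_nonneg _)
      _ = ‖b t x‖ := one_mul _
  refine ⟨fun t x => χ t • b t x, ?_, ?_, ?_, ?_, hnorm, ?_, ?_⟩
  · -- joint smoothness of `(t, x) ↦ χ t • b t x` on the slab
    have hχs' : ContDiffOn ℝ ∞ (fun p : ℝ × EuclideanSpace ℝ (Fin 3) => χ p.1)
        (Ico tb T ×ˢ univ) := (hχs.comp contDiff_fst).contDiffOn
    exact hχs'.smul hsm
  · -- divergence free slices
    intro t ht x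
    have hd : DifferentiableAt ℝ (b t) x :=
      ((hsm.contDiff_slice ht).differentiable (by simp)) x
    rw [divergence_const_smul_apply hd, hdiv t ht x, mul_zero]
  · -- the Type-I rate with the same constant
    intro t ht x
    exact (hnorm t x).trans (hrate t ht x)
  · -- agreement with `b` for `t ≤ T′`
    intro t _ htT'
    funext x
    show χ t • b t x = b t x
    rw [hχone t htT', one_smul]
  · -- a uniform bound
    refine ⟨C / Real.sqrt (T - T₁), fun t ht x => ?_⟩
    by_cases hle : T₁ ≤ t
    · show ‖χ t • b t x‖ ≤ C / Real.sqrt (T - T₁)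
      rw [hχzero t hle, zero_smul, norm_zero]
      exact div_nonneg hC (Real.sqrt_nonneg _)
    · push Not at hle
      have h1 : ‖b t x‖ ≤ C / Real.sqrt (T - t) := hrate t ht x
      have h2 : C / Real.sqrt (T - t) ≤ C / Real.sqrt (T - T₁) :=
        div_le_div_of_nonneg_left hC (Real.sqrt_pos.2 (by linarith))
          (Real.sqrt_le_sqrt (by linarith))
      exact ((hnorm t x).trans h1).trans h2
  · -- vanishing near the pole
    refine ⟨T₁, ⟨hT₁', hT₁T⟩, fun t ht x => ?_⟩
    show χ t • b t x = 0
    rw [hχzero t ht.1, zero_smul]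

/-- **Registered sub-goal `stub_typeICutoff`** (explicit-argument form of `kernel_typeI_cutoff`):
the smooth temporal cut-off of a Type-I drift used by the composition of the line. -/
theorem stub_typeICutoff :
    ∀ (C tb T T' : ℝ) (b : ℝ → EuclideanSpace ℝ (Fin 3) → EuclideanSpace ℝ (Fin 3)), 0 ≤ C →
      IsSmoothSpaceTimeOn (Ico tb T) b →
      (∀ t ∈ Ico tb T, VectorCalculus.IsDivFree (b t)) →
      (∀ t ∈ Ico tb T, ∀ x, ‖b t x‖ ≤ C / Real.sqrt (T - t)) → T' < T →
      ∃ b' : ℝ → EuclideanSpace ℝ (Fin 3) → EuclideanSpace ℝ (Fin 3),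
        IsSmoothSpaceTimeOn (Ico tb T) b' ∧
        (∀ t ∈ Ico tb T, VectorCalculus.IsDivFree (b' t)) ∧
        (∀ t ∈ Ico tb T, ∀ x, ‖b' t x‖ ≤ C / Real.sqrt (T - t)) ∧
        (∀ t ∈ Ico tb T, t ≤ T' → b' t = b t) ∧
        (∀ t x, ‖b' t x‖ ≤ ‖b t x‖) ∧
        (∃ B : ℝ, ∀ t ∈ Ico tb T, ∀ x, ‖b' t x‖ ≤ B) ∧
        (∃ T₁ ∈ Ioo T' T, ∀ t ∈ Ico T₁ T, ∀ x, b' t x = 0) :=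
  fun _ _ _ _ _ hC hsm hdiv hrate hT' => kernel_typeI_cutoff hC hsm hdiv hrate hT'

end Summit.NavierStokesRegularity.NavierStokesRegularity.Theorems.AdaptedKernelExists.NashEntropyLastBlock

end
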